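import Summits.Langlands.Langlands.Theorems.IrreducibilityBySelfDualityReciprocityUpToIrreducibilitySphericalZetaGLn
import Summits.Langlands.Langlands.Theorems.IrreducibilityBySelfDualityReciprocityUpToIrreducibilityCornerDiagonalComm
import Summits.Langlands.Langlands.Theorems.IrreducibilityBySelfDualityReciprocityUpToIrreducibilityRecGLUnramifiedOfDvd
import Summits.Langlands.Langlands.Theorems.IrreducibilityBySelfDualityReciprocityUpToIrreducibilityUnramifiedMatchingConverse
import Summits.Langlands.Langlands.Theorems.IrreducibilityBySelfDualityReciprocityUpToIrreducibilityRankTwoConverseAbove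
import HarnessLib

/-!
# Line `Sketch` for the crux `ReciprocityUpToIrreducibility` (item stmt-Langlands-14328), continuation c6:
# the rank-`n` unramified matching for EVERY reciprocity datum, WITHOUT the Jacquet–Shalika named fact

Support file (closes nothing; continuation lead c6, assembly of wave N6': stubs S1
`stub_rsZeta_fin_one_eq_integral_corner`, S2 `stub_spherical_whittaker_corner`, S3
`stub_whittaker_corner_diagonal_comm`, S4 `stub_rsZeta_spherical_trivial_eq`, S7'
`stub_recGL_unramified_of_dvd`, all landed).

c5 proved, for cuspidal `π` on `GL_n(𝔸_K)` (`2 ≤ n`), `ρ : Γ_K → GL_n(ℚ̄_ℓ)` and EVERY `Rec`, that the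
summit's local–global clause `LocalGlobalCompatibleAt Rec ι π ρ v` holds at every Satake-compatible place
(and conversely at `v ∤ ℓ`, `π_v` unramified) — but for `n ≥ 3` only MODULO the named fact
`hasRSLFactor_of_isSatakeParameter_haar` of `RankinSelbergLocal` at `(n, 1)`, the full Jacquet–Shalika
unramified computation `L(s, π_v × 1) = ∏ (1 - a q^{-s})⁻¹` in the sense of `HasRSLFactor` (in the tree
for `n = 2` only: its clause (a) for ALL test vectors needs Jacquet-module finiteness).  This file removes
that hypothesis for every `n`:

* `prod_one_sub_C_mul_X_dvd_of_hasRSLFactor_gl` — **the unramified `L`-factor divides every JPSS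
  `L`-polynomial of `(π, 1)` on `GL_n`** (`n ≥ 2`): for `π` irreducible smooth `ψ`-generic with Satake
  parameter `α`, every `P` with `HasRSLFactor hn π 1_{GL₁} ψ ν P` is divisible by `∏_{a ∈ α} (1 - a T)`
  — ONE spherical test vector: its `(n,1)` zeta integral against the constant Whittaker function of `1`
  is EXACTLY `μ'(𝒪ˣ) Λ_a(v) / ∏ (1 - a q^{-s})` (stubs S1–S4: corner torus integral, Shintani corner torus
  sum, shells; `Λ_a = Λ ∘ π(diag(1, a⁻¹, …, a^{1-n}))` an `aψ`-Whittaker functional of conductor `𝒪`,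
  whose zeta integral is that of `W_{Λ, π(d) v}` by S3), with `Λ_a(v) ≠ 0` (Casselman–Shalika,
  `exists_spherical_whittaker_ne_zero_of_isSatakeParameter`), while clause (a) makes it
  `R(q^{-s}) / P(q^{-s})` with `R` Laurent (`dvd_of_eval_mul_eq_const`).  Rank-`n` form of the tree's
  `prod_one_sub_C_mul_X_dvd_of_hasRSLFactor` (`GL2UnramifiedLFactorDivisibility`).
* `recGL_unramified_of_isSatakeParameter_gl`, `recGL_unramified_of_hasSatakeParamAt` — **stub H4
  WITHOUT `hJS`**: for every local Langlands datum `L`, every Frobenius-semisimple representative of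
  `L.recGL n ⟦π_v⟧` (`π_v` generic irreducible with Satake parameter `α`, e.g. a local component of a
  cuspidal `π` with `HasSatakeParamAt v α`) is unramified, `N = 0`, with `char(Φ) = ∏ (X - a)`: clause
  (iii-L) supplies THE `L`-polynomial `P = det(1 - TΦ | (rec π_v ⊗ rec 1)^{I,N=0})`, of degree `≤ n`, so
  divisibility + `deg = n` + `P(0) = 1` give `P = ∏ (1 - a T)` and H4's degree argument runs (stub S7').
* `localGlobalCompatibleAt_of_satakeFrobCompatibleAt`, `corresponds_of_badPlaces`,
  `satakeFrobCompatibleAt_of_localGlobalCompatibleAt_away`,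
  `localGlobalCompatibleAt_iff_satakeFrobCompatibleAt_away`,
  `satakeFrobCompatibleAt_of_localGlobalCompatibleAt_above_of_isUnramifiedAt`,
  `localGlobalCompatibleAt_iff_satakeFrobCompatibleAt_above_of_isUnramifiedAt` — **for `GL_n`, every
  `n ≥ 2`, EVERY `Rec`**: at a place where `π_v` is unramified the summit's rendering of Taylor's
  Conj. 7 IS Buzzard–Gee's unramified clause (`v ∤ ℓ`; and `v ∣ ℓ` on the `ρ`-unramified sector under
  `FontaineDatumExists`), and `Corresponds Rec ι π ρ` reduces to the finitely many non-Satake places —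
  c5's `…_of_unramifiedComputation` theorems with the Jacquet–Shalika hypothesis DISCHARGED.  The only
  named fact left anywhere in these statements is `FontaineDatumExists` (at `v ∣ ℓ`).

No definitions; std axioms.

References: H. Jacquet, J. Shalika, Amer. J. Math. 103 (1981), §2 [JacquetShalika1981]; H. Jacquet,
I. Piatetski-Shapiro, J. Shalika, Amer. J. Math. 105 (1983), Thm. 2.7 [JacquetPiatetskiShapiroShalika1983];
J. Cogdell, *Analytic theory of L-functions for GL_n* (2004), Thm. 3.3 [CogdellAnalyticTheory2004];
T. Shintani, Proc. Japan Acad. 52 (1976) [Shintani1976]; W. Casselman, J. Shalika, Compositio Math. 41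
(1980), Thm. 5.4 [CasselmanShalika1980]; M. Harris, R. Taylor, Ann. of Math. Studies 151 (2001), Thm. A
[HarrisTaylorAMS2001]; J. Tate, Corvallis 1979, (4.1.3)–(4.2.1) [TateCorvallis1979]; K. Buzzard, T. Gee,
LMS Lecture Notes 414 (2014), Conj. 3.2.1–3.2.2 [BuzzardGeeLMS2014]; J.-M. Fontaine, Astérisque 223,
Exp. VIII §2.3.7 [FontaineAsterisque223VIII].
-/

noncomputable section

set_option linter.dupNamespace false -- project-wide option (lakefile weak.linter.dupNamespace); `Summit.Langlands.Langlands` is the mandated namespace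

open scoped MatrixGroups Matrix NumberField Classical Polynomial NNReal
open Filter IsDedekindDomain Field Polynomial MeasureTheory
open Literature.NumberTheory.Automorphic Literature.NumberTheory.GaloisRepresentations
open Literature.NumberTheory.PAdicHodge
open Literature.NumberTheory.GaloisRepresentations.IsNonarchimedeanLocalField
open Summit.Langlands

namespace Summit.Langlands.Langlands.Theorems.ReciprocityUpToIrreducibility

/-! ### The unramified `L`-factor divides every JPSS `L`-polynomial of `(π, 1)` on `GL_n` -/

section Local

variable {F : Type} [Field F] [ValuativeRel F] [TopologicalSpace F] [IsNonarchimedeanLocalField F]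

/-- **The unramified `L`-factor divides every JPSS `L`-polynomial of `(π, 1)` on `GL_n`** (`2 ≤ n`), for
EVERY `GL₁(F)`-invariant Radon full-support measure `ν` on `GL₁(F) ⧸ U₁`.  Let `π` be an irreducible
smooth `ψ`-generic representation of `GL_n(F)` (`ψ` continuous non-trivial, ANY conductor) and `α` a
Satake parameter of `π` (`IsSatakeParameter π ϖ α`, `ϖ` uniformising).  Then every `P` with
`HasRSLFactor hn π 𝟙_{GL₁} ψ ν P` is divisible by `∏_{a ∈ α} (1 - a X)`: with `aψ` of conductor `𝒪`,
`Λ_a = Λ ∘ π(diag(1, a⁻¹, …, a^{1-n}))` (an `aψ`-Whittaker functional) and a spherical Hecke eigenvector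
`v` with `Λ_a(v) ≠ 0` (Casselman–Shalika), the `(n,1)` zeta integral of `W_{Λ, π(d) v} ∈ 𝒲(π, ψ)`
against the constant Whittaker function of `𝟙` equals that of `W_{Λ_a, v}` (stubs S1, S3) and is EXACTLY
`μ'(𝒪ˣ) Λ_a(v) / ∏ (1 - a q^{-s})` for `re s ≫ 0` (stub S4), while clause (a) makes it
`R(q^{-s}) / P(q^{-s})` with `R` Laurent; compare (`dvd_of_eval_mul_eq_const`).  Rank-`n` form of
`prod_one_sub_C_mul_X_dvd_of_hasRSLFactor` (`GL2UnramifiedLFactorDivisibility`).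
[cite: JacquetShalika1981, §2] [cite: JacquetPiatetskiShapiroShalika1983, Thm. 2.7 (ii)]
[cite: CogdellAnalyticTheory2004, Thm. 3.3] -/
theorem prod_one_sub_C_mul_X_dvd_of_hasRSLFactor_gl {n : ℕ} (hn : 1 < n)
    {V : Type} [AddCommGroup V] [Module ℂ V] (π : Representation ℂ (GL (Fin n) F) V)
    [MeasurableSpace (GL (Fin 1) F ⧸ upperUnitriangular (Fin 1) F)]
    [BorelSpace (GL (Fin 1) F ⧸ upperUnitriangular (Fin 1) F)]
    [π.IsIrreducible] {ψ : AddChar F Circle} (hψ : ψ.IsContinuousNontrivial)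
    (hgen : IsGeneric π ψ) {ϖ : Fˣ} (hϖ : IsUniformizingElement (ϖ : F)) {α : Multiset ℂ}
    (hα : IsSatakeParameter π ϖ α)
    (ν : Measure (GL (Fin 1) F ⧸ upperUnitriangular (Fin 1) F))
    [SMulInvariantMeasure (GL (Fin 1) F) (GL (Fin 1) F ⧸ upperUnitriangular (Fin 1) F) ν]
    [IsFiniteMeasureOnCompacts ν] [ν.IsOpenPosMeasure] {P : ℂ[X]}
    (hP : HasRSLFactor hn π (Representation.trivial ℂ (GL (Fin 1) F) ℂ) ψ ν P) :
    (α.map fun a => (1 : ℂ[X]) - C a * X).prod ∣ P := by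
  -- adapted from `Literature.NumberTheory.Automorphic.prod_one_sub_C_mul_X_dvd_of_hasRSLFactor` (`n = 2`)
  classical
  letI : MeasurableSpace F := borel F
  haveI : BorelSpace F := ⟨rfl⟩
  haveI : T2Space F :=
    (Literature.NumberTheory.GaloisRepresentations.IsNonarchimedeanLocalField.isLocalField F).toT2Space
  haveI : BorelSpace Fˣ := Units.borelSpace
  set q : ℕ := residueFieldCard F with hq_def
  have hq : 1 < q := one_lt_residueFieldCard F
  -- a dilate `aψ` of conductor `𝒪` and the shifted Whittaker functional `Λ_a = Λ ∘ π(d)`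
  obtain ⟨a₀, ha₀, hψa⟩ := hψ.exists_mulShift_hasConductorExp_zero
  set a : Fˣ := Units.mk0 a₀ ha₀ with ha_def
  have hψa' : (ψ.mulShift (a : F)).HasConductorExp 0 := hψa
  obtain ⟨Λ, hΛ, hΛ0⟩ := (isGeneric_iff π ψ).1 hgen
  set d : Fin n → Fˣ := fun i => a⁻¹ ^ (i : ℕ) with hd_def
  set D : GL (Fin n) F := diagonalGL (Fin n) F d with hD_def
  set Λa : Module.Dual ℂ V := Λ ∘ₗ (π D : V →ₗ[ℂ] V) with hΛa_def
  have hΛa : Λa ∈ whittakerFunctionals π (ψ.mulShift (a : F)) :=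
    comp_diagonalGL_mem_whittakerFunctionals π ψ hΛ d a (fun i j hij => pow_inv_mul_inv_eq a hij)
  have hΛa0 : Λa ≠ 0 := dual_comp_rep_ne_zero π hΛ0 D
  -- the spherical Hecke eigenvector, `Λ_a(v) ≠ 0`
  obtain ⟨v, hv, -, hΛv, hTv⟩ :=
    exists_spherical_whittaker_ne_zero_of_isSatakeParameter π hϖ hψa' hα hΛa hΛa0
  obtain ⟨x, hx⟩ := exists_univ_val_map_eq (R := ℂ) hα.1
  have hmk : Units.mk0 ((ϖ : Fˣ) : F) hϖ.ne_zero = ϖ := Units.mk0_val _ _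
  have hT : ∀ r, 1 ≤ r → r ≤ n → heckeT π (Units.mk0 ((ϖ : Fˣ) : F) hϖ.ne_zero) r v =
      ((((Real.sqrt (residueFieldCard F)) ^ (r * (n - r)) : ℝ) : ℂ) * α.esymm r) • v := by
    intro r _ hr
    rw [hmk]
    exact hTv r hr
  -- the Haar measure `μ'` of `Fˣ` behind `ν`, and the constant `c = μ'(𝒪ˣ) Λ_a(v) ≠ 0`
  obtain ⟨μ', hμ', hint⟩ := exists_isHaarMeasure_integral_eq ν
  haveI := hμ'
  set c : ℂ := ((μ' {x : Fˣ | ValuativeRel.valuation F (x : F) = 1}).toReal : ℂ) * Λa v with hc_def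
  have hc0 : c ≠ 0 := by
    refine mul_ne_zero ?_ hΛv
    exact_mod_cast (ENNReal.toReal_pos (measure_unitSphere_pos μ').ne'
      (measure_unitSphere_lt_top μ').ne).ne'
  -- the test pair `(Λ, π(d) v)` for `ψ` and `(id, 1)` for the trivial representation: clause (a)
  have hid : (LinearMap.id : Module.Dual ℂ ℂ) ∈
      whittakerFunctionals (Representation.trivial ℂ (GL (Fin 1) F) ℂ) ψ⁻¹ := by
    rw [whittakerFunctionals_eq_top_of_fin_one]
    exact Submodule.mem_top
  obtain ⟨R, hR, hRe⟩ := hP.2.1 Λ hΛ LinearMap.id hid (π D v) 1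
  have hW' : ∀ g, whittakerModel (Representation.trivial ℂ (GL (Fin 1) F) ℂ) LinearMap.id (1 : ℂ) g =
      (1 : ℂ) := fun g => by
    rw [whittakerModel_trivial_apply]; rfl
  -- the zeta integral of `W_{Λ, π(d) v}` is that of `W_{Λ_a, v}` (both only sample the corner torus)
  have hZeq : ∀ s : ℂ, rsZeta hn ν (whittakerModel π Λ (π D v))
      (whittakerModel (Representation.trivial ℂ (GL (Fin 1) F) ℂ) LinearMap.id 1) s =
      rsZeta hn ν (whittakerModel π Λa v)
        (whittakerModel (Representation.trivial ℂ (GL (Fin 1) F) ℂ) LinearMap.id 1) s := by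
    intro s
    rw [stub_rsZeta_fin_one_eq_integral_corner F n hn μ' ν hint _ _ 1 hW' s,
      stub_rsZeta_fin_one_eq_integral_corner F n hn μ' ν hint _ _ 1 hW' s]
    refine integral_congr_ae (Eventually.of_forall fun h => ?_)
    simp only [hΛa_def, hD_def]
    rw [(stub_whittaker_corner_diagonal_comm F n hn V π Λ v d).1 h]
  -- Part 4: `P_α(q^{-s}) Z(s) = c` for `re s` large (stub S4), and the comparison
  obtain ⟨c₀, hc₀⟩ := exists_forall_norm_mul_mul_qpow_lt_one hq α ({1} : Multiset ℂ)
  refine dvd_of_eval_mul_eq_const hq hP.ne_zero ?_ _ hR hRe hc0 (σ₀ := c₀) fun s hs => ?_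
  · rw [← satakePairPolynomial_singleton_one, eval_zero_satakePairPolynomial]
    exact one_ne_zero
  · have hs1 := hc₀ s hs
    have hs' : ∀ b ∈ α, ‖b * (q : ℂ) ^ (-s)‖ < 1 := fun b hb => by
      simpa only [mul_one] using hs1 b hb 1 (Multiset.mem_singleton_self _)
    have hD : ((α.map fun a => (1 : ℂ[X]) - C a * X).prod).eval ((q : ℂ) ^ (-s)) ≠ 0 := by
      rw [← satakePairPolynomial_singleton_one]
      exact eval_satakePairPolynomial_ne_zero_of_norm_lt_one hs1
    rw [hZeq s, stub_rsZeta_spherical_trivial_eq F n hn V π ((ϖ : Fˣ) : F) hϖ (ψ.mulShift (a : F))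
      hψa' Λa hΛa v hv α x hx hT μ' ν hint LinearMap.id 1 s hs', LinearMap.id_apply, mul_one, hc_def,
      ← hq_def]
    field_simp

/-- **Stub H4 without the Jacquet–Shalika hypothesis (local form).**  Let `d` be a local Langlands datum
of `F`, `π_v` an irreducible smooth `ψ`-generic representation of `GL_n(F)` (`2 ≤ n`) with Satake
parameter `α` w.r.t. the uniformiser `ϖ`.  Then every Frobenius-semisimple representative `A` of
`d.recGL n ⟦π_v⟧` has `N = 0`, is trivial on inertia, and `char(A.ρ Φ) = ∏_{a ∈ α} (X - a)` at every
geometric Frobenius `Φ` — stub S7' (`stub_recGL_unramified_of_dvd`: clause (iii-L), degree bound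
`natDegree_eulerFactor_le`, `P(0) = 1`) fed with the divisibility
`prod_one_sub_C_mul_X_dvd_of_hasRSLFactor_gl` and `a ≠ 0` (`IsSatakeParameter.forall_ne_zero_holds`).
[cite: HarrisTaylorAMS2001, Thm. A (ii), (v)] [cite: JacquetShalika1981, §2] [cite: TateCorvallis1979, (4.1.6)] -/
theorem recGL_unramified_of_isSatakeParameter_gl (d : LocalLanglandsDatum F) {n : ℕ} (hn : 1 < n)
    (πv : SmoothIrrep (GL (Fin n) F)) {ψ : AddChar F Circle} (hψ : ψ.IsContinuousNontrivial)
    (hgen : IsGeneric πv.ρ ψ) {ϖ : Fˣ} (hϖ : (ValuativeRel.valuation F).IsUniformizer (ϖ : F))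
    {α : Multiset ℂ} (hα : IsSatakeParameter πv.ρ ϖ α)
    (A : WeilDeligneRep F ℂ (Fin n → ℂ)) (hA : A.IsFrobSemisimple)
    (hrec : d.recGL n (IrrClass.mk πv) = Quotient.mk (frobSemisimpleWDSetoid F n) ⟨A, hA⟩) :
    A.N = 0 ∧ WeilGroup.IsUnramifiedRep A.ρ ∧
      ∀ Φ : WeilGroup F, WeilGroup.deg Φ = -1 →
        (A.ρ Φ).charpoly = (α.map fun a => X - C a).prod := by
  haveI := πv.isIrreducible
  refine stub_recGL_unramified_of_dvd F d n hn πv ψ hψ hgen α hα.1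
    (fun a ha => IsSatakeParameter.forall_ne_zero_holds hϖ hα a ha) ?_ A hA hrec
  intro _ _ ν _ _ _ P hP
  exact prod_one_sub_C_mul_X_dvd_of_hasRSLFactor_gl hn πv.ρ hψ hgen
    (isUniformizingElement_of_isUniformizer hϖ) hα ν hP

end Local

/-! ### Stub H4 unconditionally: `rec_v(π_v)` is unramified with the Satake characteristic polynomial -/

section Global

variable {K : Type} [Field K] [NumberField K] {ℓ : ℕ} [Fact ℓ.Prime] {n : ℕ}

/-- **Stub H4 WITHOUT `hJS` (global form; the signature of c5's registered stub
`stub_recGL_unramified_of_unramifiedComputation` with its Jacquet–Shalika hypothesis deleted).**  For a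
cuspidal `π` on `GL_n(𝔸_K)` (`2 ≤ n`) with Satake parameter `α` at `v`, a local component `π_v` of `π`
at `v` and ANY local Langlands datum `L` of `K_v`, every Frobenius-semisimple representative `A` of
`L.recGL n ⟦π_v⟧` has `N = 0`, is trivial on inertia, and `char(A.ρ Φ) = ∏_{a ∈ α} (X - a)` for every
geometric Frobenius `Φ`: `π_v` is generic (`exists_isGeneric_of_hasLocalComponentAt`), `α` is a Satake
parameter of `π_v` w.r.t. `artin Φ₀` (`isSatakeParameter_of_hasLocalComponentAt`), and
`recGL_unramified_of_isSatakeParameter_gl`. [cite: JacquetShalika1981, §2]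
[cite: HarrisTaylorAMS2001, Thm. A (ii), (v)] [cite: TateCorvallis1979, (4.1.6)] -/
theorem recGL_unramified_of_hasSatakeParamAt (hn : 1 < n) (hcpt : isCompact_glFiniteIntegralLevel n K)
    (π : CuspidalAutomorphicRepData n K hcpt) (v : HeightOneSpectrum (𝓞 K)) (α : Multiset ℂ)
    (hαsat : π.1.HasSatakeParamAt v α) (L : LocalLanglandsDatum (v.adicCompletion K))
    (πv : SmoothIrrep (GL (Fin n) (v.adicCompletion K))) (hloc : π.1.HasLocalComponentAt v πv.ρ)
    (A : WeilDeligneRep (v.adicCompletion K) ℂ (Fin n → ℂ)) (hA : A.IsFrobSemisimple)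
    (hrec : L.recGL n (IrrClass.mk πv) =
      Quotient.mk (frobSemisimpleWDSetoid (v.adicCompletion K) n) ⟨A, hA⟩) :
    A.N = 0 ∧ WeilGroup.IsUnramifiedRep A.ρ ∧
      ∀ Φ : WeilGroup (v.adicCompletion K), WeilGroup.deg Φ = -1 →
        (A.ρ Φ).charpoly = (α.map fun a => X - C a).prod := by
  haveI : NeZero n := ⟨by omega⟩
  haveI := πv.isIrreducible
  obtain ⟨ψ, hψ, hgen⟩ := π.exists_isGeneric_of_hasLocalComponentAt v πv.ρ πv.isSmooth hloc
  have hϖ := L.artin.artin_frob (WeilDeligneRep.geomFrob _ L.hex)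
    (WeilDeligneRep.deg_geomFrob L.hmul L.huniq L.hex)
  have hαv := π.isSatakeParameter_of_hasLocalComponentAt v πv.ρ πv.isSmooth hloc hαsat hϖ
  exact recGL_unramified_of_isSatakeParameter_gl L hn πv hψ hgen hϖ hαv A hA hrec

/-! ### The matching for `GL_n` and every `Rec`, unconditionally -/

/-- **`GL_n`, `2 ≤ n`, EVERY reciprocity datum: local–global compatibility at every Satake-compatible
place** (under `FontaineDatumExists` at `v ∣ ℓ` only).  For `π` cuspidal on `GL_n(𝔸_K)`,
`ρ : Γ_K → GL_n(ℚ̄_ℓ)` and `v` with `SatakeFrobCompatibleAt ι π ρ v`: `LocalGlobalCompatibleAt Rec ι π ρ v`.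
c5's `localGlobalCompatibleAt_of_satakeFrobCompatibleAt_of_unramifiedComputation` with its Jacquet–Shalika
hypothesis discharged by `recGL_unramified_of_hasSatakeParamAt` (stubs H1, H2 + §1e unchanged).
[cite: BuzzardGeeLMS2014, Conj. 3.2.1–3.2.2] [cite: HarrisTaylorAMS2001, Thm. A (ii), (v)]
[cite: TateCorvallis1979, (4.1.3)–(4.2.1)] [cite: JacquetShalika1981, §2] -/
theorem localGlobalCompatibleAt_of_satakeFrobCompatibleAt (hF : FontaineDatumExists) (hn : 1 < n)
    {hcpt : isCompact_glFiniteIntegralLevel n K} (Rec : ReciprocityData K) (ι : PadicAlgCl ℓ ≃+* ℂ)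
    (π : CuspidalAutomorphicRepData n K hcpt) (ρ : FramedGaloisRep K (PadicAlgCl ℓ) n)
    {v : HeightOneSpectrum (𝓞 K)} (hsat : SatakeFrobCompatibleAt ι π.1 ρ v) :
    LocalGlobalCompatibleAt Rec ι π.1 ρ v := by
  -- adapted from c5's `localGlobalCompatibleAt_of_satakeFrobCompatibleAt_of_unramifiedComputation`
  obtain ⟨α, hα, hρ, hcp⟩ := hsat
  obtain ⟨πv, hloc⟩ := AutomorphicRepData.exists_hasLocalComponentAt_of_isAdmissible
    (automorphicRep_isAdmissible_holds hcpt) π.1 v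
  obtain ⟨rℂ, htr⟩ := exists_isTransportAlong (ι : PadicAlgCl ℓ →+* ℂ)
    (WeilDeligneRep.ofRep ((ρ.toLocal v).weilRestrict (v.adicCompletion K))
      (isLocallyUnramified_toLocal_of_isUnramifiedAt ρ v hρ).isUnramifiedRep_weilRestrict.isContinuousRep)
  obtain ⟨hN, hunr, hchar⟩ := stub_transport_frobCharpoly K ℓ n ι ρ v hρ α hcp rℂ htr
  have hcls : rℂ.HasFrobSemisimpleClass ((Rec.llc v).recGL n (IrrClass.mk πv)) :=
    hasFrobSemisimpleClass_of_unramified_charpoly rℂ hN hunr _ hchar _ fun A hA hAc =>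
      recGL_unramified_of_hasSatakeParamAt hn hcpt π v α hα (Rec.llc v) πv hloc A hA hAc
  by_cases hv : ((ℓ : ℕ) : 𝓞 K) ∈ v.asIdeal
  · exact localGlobalCompatibleAt_above_of_isUnramifiedAt hF Rec ι π.1 ρ hv hρ πv hloc rℂ htr hcls
  · exact localGlobalCompatibleAt_away_of_isUnramifiedAt Rec ι π.1 ρ hv hρ
      (WeilGroup.exists_inertiaCharacter_ne_one_top (F := v.adicCompletion K) (PadicAlgCl ℓ))
      πv hloc rℂ htr hcls

/-- **`GL_n`, every `Rec`: `Corresponds` reduces to the bad places** — the places where `ρ` is not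
Satake–Frobenius compatible with `π` (finitely many for an a.e.-compatible pair); the exact residue of the
line's open stubs `stub_pairCompatibilityAway` / `…Above` in rank `n`, unconditionally but for
`FontaineDatumExists`. [cite: BuzzardGeeLMS2014, Conj. 3.2.1–3.2.2] [cite: JacquetShalika1981, §2] -/
theorem corresponds_of_badPlaces (hF : FontaineDatumExists) (hn : 1 < n)
    {hcpt : isCompact_glFiniteIntegralLevel n K} (Rec : ReciprocityData K) (ι : PadicAlgCl ℓ ≃+* ℂ)
    (π : CuspidalAutomorphicRepData n K hcpt) (ρ : FramedGaloisRep K (PadicAlgCl ℓ) n)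
    (hae : ∀ᶠ v : HeightOneSpectrum (𝓞 K) in cofinite, SatakeFrobCompatibleAt ι π.1 ρ v)
    (hbad : ∀ v : HeightOneSpectrum (𝓞 K), ¬ SatakeFrobCompatibleAt ι π.1 ρ v →
      LocalGlobalCompatibleAt Rec ι π.1 ρ v) :
    Corresponds Rec ι π.1 ρ := by
  refine ⟨hae, fun v => ?_⟩
  by_cases h : SatakeFrobCompatibleAt ι π.1 ρ v
  · exact localGlobalCompatibleAt_of_satakeFrobCompatibleAt hF hn Rec ι π ρ h
  · exact hbad v h

/-- **`GL_n`, `v ∤ ℓ`, every `Rec`: local–global compatibility at an unramified place of `π` forces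
Satake–Frobenius compatibility** — c5's
`satakeFrobCompatibleAt_of_localGlobalCompatibleAt_away_of_unramifiedComputation` with `hJS` discharged:
the Frobenius-semisimplification `rℂ^{F-ss}` lies in `rec_v(π_v)` and is unramified with the Satake
characteristic polynomial (`recGL_unramified_of_hasSatakeParamAt`), these pass to `rℂ`, and the rank-`n`
Weil–Deligne bridge (stub Cn) returns the Satake clause. [cite: HarrisTaylorAMS2001, Thm. A (ii), (v)]
[cite: TateCorvallis1979, (4.1.6)–(4.2.1)] [cite: JacquetShalika1981, §2] -/
theorem satakeFrobCompatibleAt_of_localGlobalCompatibleAt_away (hn : 1 < n)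
    {hcpt : isCompact_glFiniteIntegralLevel n K} (Rec : ReciprocityData K) (ι : PadicAlgCl ℓ ≃+* ℂ)
    (π : CuspidalAutomorphicRepData n K hcpt) (ρ : FramedGaloisRep K (PadicAlgCl ℓ) n)
    {v : HeightOneSpectrum (𝓞 K)} (hv : ((ℓ : ℕ) : 𝓞 K) ∉ v.asIdeal)
    (hπ : π.1.IsUnramifiedAt v) (hLG : LocalGlobalCompatibleAt Rec ι π.1 ρ v) :
    SatakeFrobCompatibleAt ι π.1 ρ v := by
  -- adapted from c5's `satakeFrobCompatibleAt_of_localGlobalCompatibleAt_away_of_unramifiedComputation`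
  obtain ⟨α, hα⟩ := hπ
  obtain ⟨πv, rv, rℂ, hloc, hWD, -, hT, r', hr', hc⟩ := hLG
  obtain ⟨hN', hρ', hchar'⟩ :=
    recGL_unramified_of_hasSatakeParamAt hn hcpt π v α hα (Rec.llc v) πv hloc r' hr'.isFrobSemisimple
      hc.symm
  have hN : rℂ.N = 0 := hr'.1.symm.trans hN'
  have hur : WeilGroup.IsUnramifiedRep rℂ.ρ := fun u hu => (hr'.2.1 u hu).symm.trans (hρ' u hu)
  have hch : ∀ Φ : WeilGroup (v.adicCompletion K), WeilGroup.deg Φ = -1 →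
      (rℂ.ρ Φ).charpoly = (α.map fun a => X - C a).prod := fun Φ hΦ => by
    obtain ⟨-, m, hm, hcm, hsum⟩ := hr'.2.2 Φ
    rw [hsum, LinearMap.charpoly_add_eq_of_isNilpotent_of_commute hm hcm, hchar' Φ hΦ]
  obtain ⟨hunr, hcp⟩ :=
    isUnramifiedAt_and_hasFrobCharpolyAt_of_weilDeligne_wdBridge ι ρ v (hWD hv) hT hN hur hch
  exact ⟨α, hα, hunr, hcp⟩

/-- **`GL_n`, every `Rec`, `v ∤ ℓ`, `π_v` unramified: the summit's local–global clause IS the Satake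
clause**, `LocalGlobalCompatibleAt Rec ι π ρ v ↔ SatakeFrobCompatibleAt ι π ρ v`, with NO named fact but
`FontaineDatumExists` (idle at `v ∤ ℓ`, kept in the signature of the `←` direction).
[cite: BuzzardGeeLMS2014, Conj. 3.2.1–3.2.2] [cite: TateCorvallis1979, (4.1.6)–(4.2.1)] -/
theorem localGlobalCompatibleAt_iff_satakeFrobCompatibleAt_away (hF : FontaineDatumExists) (hn : 1 < n)
    {hcpt : isCompact_glFiniteIntegralLevel n K} (Rec : ReciprocityData K) (ι : PadicAlgCl ℓ ≃+* ℂ)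
    (π : CuspidalAutomorphicRepData n K hcpt) (ρ : FramedGaloisRep K (PadicAlgCl ℓ) n)
    {v : HeightOneSpectrum (𝓞 K)} (hv : ((ℓ : ℕ) : 𝓞 K) ∉ v.asIdeal) (hπ : π.1.IsUnramifiedAt v) :
    LocalGlobalCompatibleAt Rec ι π.1 ρ v ↔ SatakeFrobCompatibleAt ι π.1 ρ v :=
  ⟨satakeFrobCompatibleAt_of_localGlobalCompatibleAt_away hn Rec ι π ρ hv hπ,
    localGlobalCompatibleAt_of_satakeFrobCompatibleAt hF hn Rec ι π ρ⟩

/-- **`GL_n`, `v ∣ ℓ`, `ρ` unramified at `v`, every `Rec`: local–global compatibility at an unramified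
place of `π` forces Satake–Frobenius compatibility** (under `FontaineDatumExists`) — the rank-`n` form of
c5's stub C2-above: c3's (F8) reduction `exists_of_localGlobalCompatibleAt_above_of_isUnramifiedAt`,
`recGL_unramified_of_hasSatakeParamAt` at the Frobenius-semisimplification, and the Galois side
`hasFrobCharpolyAt_of_isTransportAlong_charpoly_aboveConv`. [cite: FontaineAsterisque223VIII, §2.3.7]
[cite: BuzzardGeeLMS2014, Conj. 3.2.1–3.2.2] [cite: TateCorvallis1979, (4.2.1)] -/
theorem satakeFrobCompatibleAt_of_localGlobalCompatibleAt_above_of_isUnramifiedAt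
    (hF : FontaineDatumExists) (hn : 1 < n) {hcpt : isCompact_glFiniteIntegralLevel n K}
    (Rec : ReciprocityData K) (ι : PadicAlgCl ℓ ≃+* ℂ) (π : CuspidalAutomorphicRepData n K hcpt)
    (ρ : FramedGaloisRep K (PadicAlgCl ℓ) n) {v : HeightOneSpectrum (𝓞 K)}
    (hv : ((ℓ : ℕ) : 𝓞 K) ∈ v.asIdeal) (hρ : ρ.IsUnramifiedAt v) (hπ : π.1.IsUnramifiedAt v)
    (hLG : LocalGlobalCompatibleAt Rec ι π.1 ρ v) : SatakeFrobCompatibleAt ι π.1 ρ v := by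
  -- adapted from c5's `rankTwo_satakeFrobCompatibleAt_of_localGlobalCompatibleAt_above_aboveConv`
  obtain ⟨α, hα⟩ := hπ
  obtain ⟨πv, rℂ, hloc, htr, r', hr', hc⟩ :=
    exists_of_localGlobalCompatibleAt_above_of_isUnramifiedAt hF Rec ι π.1 ρ hv hρ hLG
  obtain ⟨-, -, hchar'⟩ := recGL_unramified_of_hasSatakeParamAt hn hcpt π v α hα (Rec.llc v) πv hloc
    r' hr'.isFrobSemisimple hc.symm
  refine ⟨α, hα, hρ, hasFrobCharpolyAt_of_isTransportAlong_charpoly_aboveConv ι ρ v hρ α rℂ htr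
    fun Φ hΦ => ?_⟩
  rw [charpoly_eq_of_isFrobSemisimplificationOf_aboveConv hr' Φ, hchar' Φ hΦ]

/-- **`GL_n`, every `Rec`, `v ∣ ℓ` with `ρ` and `π` unramified at `v`: the clause IS the Satake clause**
(under `FontaineDatumExists`). [cite: FontaineAsterisque223VIII, §2.3.7] [cite: BuzzardGeeLMS2014, Conj. 3.2.1–3.2.2] -/
theorem localGlobalCompatibleAt_iff_satakeFrobCompatibleAt_above_of_isUnramifiedAt
    (hF : FontaineDatumExists) (hn : 1 < n) {hcpt : isCompact_glFiniteIntegralLevel n K}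
    (Rec : ReciprocityData K) (ι : PadicAlgCl ℓ ≃+* ℂ) (π : CuspidalAutomorphicRepData n K hcpt)
    (ρ : FramedGaloisRep K (PadicAlgCl ℓ) n) {v : HeightOneSpectrum (𝓞 K)}
    (hv : ((ℓ : ℕ) : 𝓞 K) ∈ v.asIdeal) (hρ : ρ.IsUnramifiedAt v) (hπ : π.1.IsUnramifiedAt v) :
    LocalGlobalCompatibleAt Rec ι π.1 ρ v ↔ SatakeFrobCompatibleAt ι π.1 ρ v :=
  ⟨satakeFrobCompatibleAt_of_localGlobalCompatibleAt_above_of_isUnramifiedAt hF hn Rec ι π ρ hv hρ hπ,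
    localGlobalCompatibleAt_of_satakeFrobCompatibleAt hF hn Rec ι π ρ⟩

/-- **Registered stub `stub_rankN_localGlobalCompatibleAt_of_satakeFrobCompatibleAt` of line `Sketch`
(crux stmt-Langlands-14328; c6 assembly of wave N6'), closed form of
`localGlobalCompatibleAt_of_satakeFrobCompatibleAt`:** under `FontaineDatumExists` (used at `v ∣ ℓ` only),
for `GL_n` with `2 ≤ n` over every number field, EVERY reciprocity datum `Rec`, every cuspidal `π`, every
`ρ` and every finite place `v`, Satake–Frobenius compatibility at `v` implies the summit's local–global
clause at `v` — with NO Jacquet–Shalika hypothesis. [cite: BuzzardGeeLMS2014, Conj. 3.2.1–3.2.2]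
[cite: HarrisTaylorAMS2001, Thm. A (ii), (v)] [cite: JacquetShalika1981, §2] -/
theorem stub_rankN_localGlobalCompatibleAt_of_satakeFrobCompatibleAt :
    FontaineDatumExists → ∀ (K : Type) [Field K] [NumberField K] (ℓ : ℕ) [Fact ℓ.Prime] (n : ℕ), 1 < n →
      ∀ (hcpt : isCompact_glFiniteIntegralLevel n K) (Rec : ReciprocityData K) (ι : PadicAlgCl ℓ ≃+* ℂ)
        (π : CuspidalAutomorphicRepData n K hcpt) (ρ : FramedGaloisRep K (PadicAlgCl ℓ) n)
        (v : HeightOneSpectrum (𝓞 K)),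
        SatakeFrobCompatibleAt ι π.1 ρ v → LocalGlobalCompatibleAt Rec ι π.1 ρ v :=
  fun hF _ _ _ _ _ _ hn _ Rec ι π ρ _ hsat =>
    localGlobalCompatibleAt_of_satakeFrobCompatibleAt hF hn Rec ι π ρ hsat

end Global

end Summit.Langlands.Langlands.Theorems.ReciprocityUpToIrreducibility

end
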